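import Summits.Ventures.YMGap.RobustBall.RobustSlabLaw
import Summits.Ventures.YMGap.SlabAreaLaw
import Summits.Ventures.YMGap.Thresholds.OneLinkTiltStability
import HarnessLib

/-!
# Robust ball (Y2), area-law side, part 5 — the ROBUST SLAB DOOR: rest-uniform clustering of the perturbed slab laws

HONEST FRAMING: venture file of the cell `pub-ymgap` (QuantumFields programme), track ROBUST-BALL.  The Dobrushin door of the slab
`σ`-model (`SlabDobrushinDoor`, `SlabAreaLaw`) RE-PROVED for the PERTURBED slab laws `slabLawW v t β W r` of `RobustSlabLaw`
(product Haar on the vertical links of the slab `{x_v = t}` tilted by `S_{A(r),B(r)}(Q) - W(glue Q r)`), with the tree's robust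
one-link lemma `OneLinkTiltStability.su_oneLink_robust_influence` (ds-4) as the engine:
* `slabSpecW` — the perturbed slab specification (single-site kernels), a specification with `slabLawW` as Gibbs measure; its one-site
  law is the re-weighted one-link law `(ν_{B_x(ω)})^{-h_{x,ω}}`, `h_{x,ω}(g) = W(glue (ω^{x←g}) r)` (`siteLaw_slabSpecW_thooft`);
* `isKRContraction_slabSpecW` — Dobrushin's condition in Kantorovich–Rubinstein form with influence coefficients
  `C(x,y) = K e^δ (1 + 2√N ℓ) |β| m(x,y) + √N Λ(x,y)` from a one-link modulus `OneLinkKRModulus N R K` (`R ≥ 2n|β|`) and ABSTRACT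
  per-site loads of the re-weighting `h`: oscillation `δ`, self-Lipschitz `ℓ`, cross-Lipschitz `Λ(x,y)`, finite neighbourhoods `nbr`;
* `slab_covariance_le_W` — covariance decay `2(2√N)² δf δg c^{ℓ(x)}` along admissible profiles, `c` = the row-sum bound, for EVERY
  rest `r` with those loads — the input `hcov` of `robust_slab_criterion` once the loads are read off the ball (bookkeeping, next file).
Strong-coupling finite-lattice statement; nothing about the continuum, a mass gap, or Clay.
-/

noncomputable section

open MeasureTheory ProbabilityTheory
open scoped Matrix
open Literature.Probability.LatticeModels hiding glue
open Literature.Probability.LatticeModels.DobrushinMetric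
open Literature.MathematicalPhysics.QuantumLattice (fundamentalRep continuous_fundamentalRep fundamentalRep_apply)
open Literature.MathematicalPhysics.QuantumFieldTheory
open Literature.MathematicalPhysics.QuantumFieldTheory.DurhuusFrohlich
open Literature.MathematicalPhysics.QuantumFieldTheory.Balaban1983to89.StrongCouplingDobrushinWindow (OneLinkKRModulus)

namespace Summit.Ventures.YMGap.RobustBall

variable {n L N : ℕ} [NeZero L] {W : GaugeConfig (n + 1) L (SU N) → ℝ}

/-! ### The perturbed slab specification -/

section Spec

variable (W) in
/-- **The perturbed slab specification** of the slab `{x_v = t}` given the off-slab links `r`: product Haar on a finite set of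
slice sites, glued with the boundary condition, tilted by `S_{A(r),B(r)}(Q) - W(glue Q r)`; its full-volume kernel is `slabLawW`
(`slabSpecW_univ`). [cite: CaoNissimSheffield2025dynamical, Definition 2.1] [cite: Georgii2011, Def. 2.9] -/
def slabSpecW (v : Fin (n + 1)) (t : ZMod L) (β : ℝ) (W : GaugeConfig (n + 1) L (SU N) → ℝ)
    (r : {e : Edge (n + 1) L // ¬ IsSlab v t e} → SU N) : Specification (TorusSite n L) (SU N) :=
  fun Λ η => ((Measure.pi fun _ : ↥Λ => haarProbability (SU N)).map (glueWith Λ · η)).tilted (slabTiltW v t β W r)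

/-- The perturbed slab specification is a Gibbsian specification. [cite: Georgii2011, Def. 2.9] -/
theorem isSpecification_slabSpecW (v : Fin (n + 1)) (t : ZMod L) (β : ℝ) (hWm : Measurable W) (hWb : ∃ C, ∀ U, |W U| ≤ C)
    (r : {e : Edge (n + 1) L // ¬ IsSlab v t e} → SU N) : IsSpecification (slabSpecW v t β W r) := by
  haveI : NeZero (haarProbability (SU N)) := ⟨IsProbabilityMeasure.ne_zero _⟩
  obtain ⟨CW, hCW⟩ := hWb
  exact isSpecification_tilted_map_glueWith_pi (V := TorusSite n L) (S := SU N) (haarProbability (SU N))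
    (φ := fun _ => slabTiltW v t β W r) (fun _ => measurable_slabTiltW v t β hWm r)
    (fun _ => ⟨_, abs_slabTiltW_le v t β hCW r⟩) (fun _ _ _ σ σ' _ => by simp)

/-- The full-volume kernel of the perturbed slab specification is the perturbed slab law. [folklore] -/
theorem slabSpecW_univ (v : Fin (n + 1)) (t : ZMod L) (β : ℝ) (r : {e : Edge (n + 1) L // ¬ IsSlab v t e} → SU N)
    (η : TorusSite n L → SU N) : slabSpecW v t β W r Finset.univ η = slabLawW v t β W r := by
  unfold slabSpecW slabLawW
  rw [Slab.map_glueWith_univ_pi_site]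

/-- The perturbed slab law is a Gibbs measure of the perturbed slab specification (finite system: DLR = consistency).
[cite: Georgii2011, Def. 1.23 / Rem. 1.24] -/
theorem isGibbsMeasure_slabLawW (v : Fin (n + 1)) (t : ZMod L) (β : ℝ) (hWm : Measurable W) (hWb : ∃ C, ∀ U, |W U| ≤ C)
    (r : {e : Edge (n + 1) L // ¬ IsSlab v t e} → SU N) :
    IsGibbsMeasure (slabSpecW v t β W r) (slabLawW v t β W r) := by
  classical
  have hγ := isSpecification_slabSpecW (n := n) (L := L) v t β hWm hWb r
  rw [← slabSpecW_univ v t β r (fun _ => 1)]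
  refine ⟨hγ.isProbability _ _, fun Λ S hS => ?_⟩
  exact hγ.consistent (Finset.subset_univ Λ) _ S hS

/-- The one-site law of the perturbed slab specification is Haar tilted by the energy section `g ↦ tilt_r(ω^{x←g})`.
[cite: Georgii2011, Def. 2.9] -/
theorem siteLaw_slabSpecW_eq_tilted (v : Fin (n + 1)) (t : ZMod L) (β : ℝ) (hWm : Measurable W)
    (r : {e : Edge (n + 1) L // ¬ IsSlab v t e} → SU N) (x : TorusSite n L) (ω : TorusSite n L → SU N) :
    siteLaw (slabSpecW v t β W r) x ω =
      (haarProbability (SU N)).tilted fun g => slabTiltW v t β W r (Function.update ω x g) := by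
  -- adapted from `Slab.siteLaw_slabSpec_eq_tilted` (the energy is arbitrary measurable)
  classical
  have hF : Measurable (slabTiltW (n := n) (L := L) v t β W r) := measurable_slabTiltW v t β hWm r
  have h1 : slabSpecW v t β W r {x} ω =
      ((Measure.pi fun _ : ↥({x} : Finset (TorusSite n L)) => haarProbability (SU N)).tilted
        (slabTiltW v t β W r ∘ fun ζ => glueWith {x} ζ ω)).map (fun ζ => glueWith {x} ζ ω) := by
    unfold slabSpecW
    rw [map_tilted_comp _ (measurable_glueWith _ ω) hF]
  have hgl : (fun ζ : ↥({x} : Finset (TorusSite n L)) → SU N => glueWith {x} ζ ω) =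
      Function.update ω x ∘ fun ζ => ζ ⟨x, Finset.mem_singleton_self x⟩ := by
    funext ζ z
    by_cases hz : z = x
    · subst hz
      simp
    · rw [Function.comp_apply, Function.update_of_ne hz,
        glueWith_apply_not_mem _ _ _ (by simpa using hz)]
  have hev : (Measure.pi fun _ : ↥({x} : Finset (TorusSite n L)) => haarProbability (SU N)).map
      (fun ζ => ζ ⟨x, Finset.mem_singleton_self x⟩) = haarProbability (SU N) :=
    (MeasureTheory.measurePreserving_eval (fun _ : ↥({x} : Finset (TorusSite n L)) =>
      haarProbability (SU N)) ⟨x, Finset.mem_singleton_self x⟩).map_eq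
  have hF' : Measurable fun g : SU N => slabTiltW v t β W r (Function.update ω x g) :=
    hF.comp (measurable_update ω)
  have key := map_tilted_comp (Measure.pi fun _ : ↥({x} : Finset (TorusSite n L)) => haarProbability (SU N))
    (measurable_pi_apply (⟨x, Finset.mem_singleton_self x⟩ : ↥({x} : Finset (TorusSite n L)))) hF'
  rw [hev] at key
  rw [siteLaw, h1, Measure.map_map (measurable_pi_apply x) (measurable_glueWith _ ω), hgl]
  have hcomp : (slabTiltW v t β W r ∘ Function.update ω x ∘ fun ζ : ↥({x} : Finset (TorusSite n L)) → SU N =>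
        ζ ⟨x, Finset.mem_singleton_self x⟩) =
      (fun g => slabTiltW v t β W r (Function.update ω x g)) ∘
        fun ζ : ↥({x} : Finset (TorusSite n L)) → SU N => ζ ⟨x, Finset.mem_singleton_self x⟩ := rfl
  have hcomp' : ((fun σ : TorusSite n L → SU N => σ x) ∘ Function.update ω x ∘
      fun ζ : ↥({x} : Finset (TorusSite n L)) → SU N => ζ ⟨x, Finset.mem_singleton_self x⟩) =
      fun ζ : ↥({x} : Finset (TorusSite n L)) → SU N => ζ ⟨x, Finset.mem_singleton_self x⟩ := by
    funext ζ; simp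
  rw [hcomp, hcomp']
  exact key

variable (W) in
/-- The **site re-weighting** of the perturbed slab law at `x` under boundary condition `ω`: `h_{x,ω}(g) = W(glue (ω^{x←g}) r)`
(the terms of `W` not reading the link `x` are constant in `g` and cancel in the one-site law). [folklore] -/
def siteTiltW (v : Fin (n + 1)) (t : ZMod L) (W : GaugeConfig (n + 1) L (SU N) → ℝ)
    (r : {e : Edge (n + 1) L // ¬ IsSlab v t e} → SU N) (x : TorusSite n L) (ω : TorusSite n L → SU N) (g : SU N) : ℝ :=
  W (glue v t (Function.update ω x g) r)

omit [NeZero L] in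
/-- The site re-weighting is measurable in the spin. [folklore] -/
theorem measurable_siteTiltW (v : Fin (n + 1)) (t : ZMod L) (hWm : Measurable W)
    (r : {e : Edge (n + 1) L // ¬ IsSlab v t e} → SU N) (x : TorusSite n L) (ω : TorusSite n L → SU N) :
    Measurable (siteTiltW v t W r x ω) :=
  hWm.comp ((measurable_glue_left v t r).comp (measurable_update ω))

omit [NeZero L] in
/-- The site re-weighting is bounded. [folklore] -/
theorem exists_abs_siteTiltW_le (v : Fin (n + 1)) (t : ZMod L) (hWb : ∃ C, ∀ U, |W U| ≤ C)
    (r : {e : Edge (n + 1) L // ¬ IsSlab v t e} → SU N) (x : TorusSite n L) (ω : TorusSite n L → SU N) :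
    ∃ M, ∀ g, |siteTiltW v t W r x ω g| ≤ M := by
  obtain ⟨C, hC⟩ := hWb; exact ⟨C, fun g => hC _⟩

/-- The boundary fields of the slab read off the rest `r`. [folklore] -/
abbrev topOf (v : Fin (n + 1)) (t : ZMod L) (r : {e : Edge (n + 1) L // ¬ IsSlab v t e} → SU N) : Edge n L → UN N :=
  topField v t (glue v t (fun _ => 1) r)

/-- The boundary fields of the slab read off the rest `r`. [folklore] -/
abbrev botOf (v : Fin (n + 1)) (t : ZMod L) (r : {e : Edge (n + 1) L // ¬ IsSlab v t e} → SU N) : Edge n L → UN N :=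
  botField v t (glue v t (fun _ => 1) r)

/-- **The one-site law of the perturbed slab specification in 't Hooft form**: the re-weighted one-link law
`(ν_{B_x(ω)})^{-h_{x,ω}}`, `ν_B(dg) ∝ exp(N Re tr(g B)) dg`, `B_x(ω)` the slab site field of the boundary fields `A(r), B(r)` —
the same family as in `OneLinkTiltStability.su_oneLink_robust_influence`. [cite: CaoNissimSheffield2025dynamical, Definition 2.1] -/
theorem siteLaw_slabSpecW_thooft (v : Fin (n + 1)) (t : ZMod L) (β : ℝ) (hWm : Measurable W)
    (r : {e : Edge (n + 1) L // ¬ IsSlab v t e} → SU N) (x : TorusSite n L) (ω : TorusSite n L → SU N)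
    (hL : ∀ e : Slab.SlabEdge n L, e.tgt ≠ e.1) :
    siteLaw (slabSpecW v t β W r) x ω =
      ((haarProbability (SU N)).tilted fun g : SU N =>
          (N : ℝ) * ((g : Matrix (Fin N) (Fin N) ℂ) * Slab.slabField β (topOf v t r) (botOf v t r) ω x).trace.re).tilted
        fun g => -siteTiltW v t W r x ω g := by
  rw [siteLaw_slabSpecW_eq_tilted v t β hWm]
  have hfun : (fun g : SU N => slabTiltW v t β W r (Function.update ω x g)) = fun g : SU N =>
      (N : ℝ) * β * (∑ e : Slab.SlabEdge n L, if e.1 ≠ x ∧ e.tgt ≠ x then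
          ((ω e.1 : Matrix (Fin N) (Fin N) ℂ) * (topOf v t r e : Matrix (Fin N) (Fin N) ℂ) *
            (ω e.tgt : Matrix (Fin N) (Fin N) ℂ)ᴴ * (botOf v t r e : Matrix (Fin N) (Fin N) ℂ)ᴴ).trace.re else 0) +
      ((N : ℝ) * (((g : Matrix (Fin N) (Fin N) ℂ) * Slab.slabField β (topOf v t r) (botOf v t r) ω x).trace.re) +
        -siteTiltW v t W r x ω g) := by
    funext g
    rw [slabTiltW, slabActionOf_glue, ← Slab.slabEnergy_eq_slabAction, Slab.slabEnergy_update β _ _ ω x g hL, siteTiltW]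
    ring
  rw [hfun, tilted_const_add_eq, OneLinkTiltStability.su_tilted_linear_add]

end Spec

/-! ### Dobrushin's condition for the perturbed slab specification -/

section Door

/-- No edge of `x` ends outside `slabNbr x`: the influence count vanishes off the neighbourhood. [folklore] -/
theorem slabInfluence_eq_zero_of_not_mem {x y : TorusSite n L} (hy : y ∉ Slab.slabNbr x) : Slab.slabInfluence x y = 0 := by
  classical
  have h1 : (Slab.outEdges x).filter (fun e => e.tgt = y) = ∅ :=
    Finset.filter_eq_empty_iff.2 fun e he h =>
      hy (by rw [Slab.slabNbr]; exact Finset.mem_union_left _ (Finset.mem_image.2 ⟨e, he, h⟩))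
  have h2 : (Slab.inEdges x).filter (fun e => e.1 = y) = ∅ :=
    Finset.filter_eq_empty_iff.2 fun e he h =>
      hy (by rw [Slab.slabNbr]; exact Finset.mem_union_right _ (Finset.mem_image.2 ⟨e, he, h⟩))
  rw [Slab.slabInfluence, h1, h2, Finset.card_empty]

/-- **Dobrushin's condition (Kantorovich–Rubinstein form) for the PERTURBED slab specification.**  Inputs: a one-link modulus
`OneLinkKRModulus N R K` on the ball `R ≥ 2n|β|`; extra neighbourhoods `nbrW x ∌ x` such that the site re-weightings `h_{x,ω}` read the boundary condition only on
`slabNbr x ∪ nbrW x` (up to `g`-independent constants); per-site loads of the re-weighting: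
oscillation `h_{x,ω}(g) - h_{x,ω}(g') ≤ δ`, self-Lipschitz `|h_{x,ω}(g) - h_{x,ω}(g')| ≤ ℓ‖g - g'‖_F`, cross-Lipschitz
`|h_{x,ω}(g) - h_{x,η}(g)| ≤ Λ(x,y)‖ω_y - η_y‖_F` for `ω = η` off `y`.  Output: `IsKRContraction` with
`C(x,y) = K e^δ (1 + 2√N ℓ) |β| m(x,y) + √N Λ(x,y)` (re-weighting leg + cross leg of `su_oneLink_robust_influence`).
[cite: Follmer1988, Ch. I (2.20)] -/
theorem isKRContraction_slabSpecW (hN : 1 ≤ N) (hL1 : L ≠ 1) (v : Fin (n + 1)) (t : ZMod L)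
    {β R K δ ℓ : ℝ} (hK : 0 ≤ K) (hℓ : 0 ≤ ℓ) (hR : |β| * (2 * (n : ℝ)) ≤ R) (hmod : OneLinkKRModulus N R K)
    (hWm : Measurable W) (hWb : ∃ C, ∀ U, |W U| ≤ C) (r : {e : Edge (n + 1) L // ¬ IsSlab v t e} → SU N)
    (nbrW : TorusSite n L → Finset (TorusSite n L)) (hnotW : ∀ x, x ∉ nbrW x)
    (hdep : ∀ x (η η' : TorusSite n L → SU N), (∀ z ∈ Slab.slabNbr x ∪ nbrW x, η z = η' z) →
      ∃ c : ℝ, ∀ g, siteTiltW v t W r x η g = c + siteTiltW v t W r x η' g)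
    (hδ : ∀ x ω g g', siteTiltW v t W r x ω g - siteTiltW v t W r x ω g' ≤ δ)
    (hℓ' : ∀ x ω g g', |siteTiltW v t W r x ω g - siteTiltW v t W r x ω g'| ≤ ℓ * suFrobDist g g')
    (Λ : TorusSite n L → TorusSite n L → ℝ) (hΛ0 : ∀ x y, 0 ≤ Λ x y)
    (hΛ : ∀ x y (ω η : TorusSite n L → SU N), (∀ z, z ≠ y → ω z = η z) → ∃ c : ℝ, ∀ g,
      |siteTiltW v t W r x ω g - (c + siteTiltW v t W r x η g)| ≤ Λ x y * suFrobDist (ω y) (η y)) :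
    IsKRContraction (slabSpecW v t β W r) suFrobDist (fun x => Slab.slabNbr x ∪ nbrW x)
      (fun x y => K * Real.exp δ * (1 + 2 * Real.sqrt N * ℓ) * |β| * (Slab.slabInfluence x y : ℝ) + Real.sqrt N * Λ x y) := by
  classical
  have hL : ∀ e : Slab.SlabEdge n L, e.tgt ≠ e.1 := Slab.SlabEdge.tgt_ne_fst hL1
  have hnot : ∀ x, x ∉ Slab.slabNbr x ∪ nbrW x := fun x =>
    Finset.notMem_union.2 ⟨Slab.not_mem_slabNbr hL x, hnotW x⟩
  refine ⟨hnot, fun x y => by have := hΛ0 x y; positivity, fun x η η' h => ?_, ?_⟩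
  · -- finite range: the site law reads `ω` on `nbr x` only (Wilson part through `slabNbr x ⊆ nbr x`, `W` part up to a constant)
    obtain ⟨c, hc⟩ := hdep x η η' h
    have hF : Slab.slabField β (topOf v t r) (botOf v t r) η x = Slab.slabField β (topOf v t r) (botOf v t r) η' x := by
      unfold Slab.slabField
      rw [Slab.slabStapleSum_congr _ _ x (fun z hz => h z (Finset.mem_union_left _ hz))]
    have hh : (fun g => -siteTiltW v t W r x η g) = fun g => -c + -siteTiltW v t W r x η' g := by
      funext g; rw [hc g]; ring
    haveI := OneLinkTiltStability.su_isProbabilityMeasure_tilted_linear (N := N)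
      (Slab.slabField β (topOf v t r) (botOf v t r) η' x)
    rw [siteLaw_slabSpecW_thooft v t β hWm r x η hL, siteLaw_slabSpecW_thooft v t β hWm r x η' hL, hF, hh]
    exact tilted_const_add_eq _ _ _
  · intro x y _ ω η hωη φ Lφ hφm hφb hL0 hφL
    obtain ⟨c, hc⟩ := hΛ x y ω η hωη
    rw [siteLaw_slabSpecW_thooft v t β hWm r x ω hL, siteLaw_slabSpecW_thooft v t β hWm r x η hL]
    have hBω : matrixOpNorm (Slab.slabField β (topOf v t r) (botOf v t r) ω x) ≤ R :=
      (Slab.matrixOpNorm_slabField_le hN β _ _ ω x).trans hR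
    have hBη : matrixOpNorm (Slab.slabField β (topOf v t r) (botOf v t r) η x) ≤ R :=
      (Slab.matrixOpNorm_slabField_le hN β _ _ η x).trans hR
    -- shifting the second re-weighting by the constant `c` does not change its one-site law
    haveI := OneLinkTiltStability.su_isProbabilityMeasure_tilted_linear (N := N)
      (Slab.slabField β (topOf v t r) (botOf v t r) η x)
    have hshift : ((haarProbability (SU N)).tilted fun g : SU N =>
          (N : ℝ) * ((g : Matrix (Fin N) (Fin N) ℂ) * Slab.slabField β (topOf v t r) (botOf v t r) η x).trace.re).tilted
          (fun g => -siteTiltW v t W r x η g) =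
        ((haarProbability (SU N)).tilted fun g : SU N =>
          (N : ℝ) * ((g : Matrix (Fin N) (Fin N) ℂ) * Slab.slabField β (topOf v t r) (botOf v t r) η x).trace.re).tilted
          (fun g => -(c + siteTiltW v t W r x η g)) := by
      have : (fun g : SU N => -(c + siteTiltW v t W r x η g)) = fun g => -c + -siteTiltW v t W r x η g := by
        funext g; ring
      rw [this, tilted_const_add_eq]
    rw [hshift]
    obtain ⟨M, hM⟩ := exists_abs_siteTiltW_le v t hWb r x η
    have key := OneLinkTiltStability.su_oneLink_robust_influence (N := N) (s := Λ x y * suFrobDist (ω y) (η y)) hℓ hmod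
      _ _ hBω hBη (siteTiltW v t W r x ω) (fun g => c + siteTiltW v t W r x η g) (measurable_siteTiltW v t hWm r x ω)
      ((measurable_siteTiltW v t hWm r x η).const_add c) ⟨|c| + M, fun g => (abs_add_le _ _).trans (by linarith [hM g])⟩
      (hδ x ω) (hℓ' x ω) hc φ Lφ hφm hφb hL0 hφL
    refine key.trans ?_
    have hdiff := Slab.frobNorm_slabField_sub_le β (topOf v t r) (botOf v t r) x y hωη
    have hfac : 0 ≤ K * Real.exp δ * (1 + 2 * Real.sqrt N * ℓ) := by positivity
    calc (K * Real.exp δ * (1 + 2 * Real.sqrt N * ℓ) *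
            frobNorm (Slab.slabField β (topOf v t r) (botOf v t r) ω x - Slab.slabField β (topOf v t r) (botOf v t r) η x) +
            Real.sqrt N * (Λ x y * suFrobDist (ω y) (η y))) * Lφ
        ≤ (K * Real.exp δ * (1 + 2 * Real.sqrt N * ℓ) * (|β| * Slab.slabInfluence x y * suFrobDist (ω y) (η y)) +
            Real.sqrt N * (Λ x y * suFrobDist (ω y) (η y))) * Lφ :=
          mul_le_mul_of_nonneg_right (add_le_add (mul_le_mul_of_nonneg_left hdiff hfac) le_rfl) hL0
      _ = (K * Real.exp δ * (1 + 2 * Real.sqrt N * ℓ) * |β| * (Slab.slabInfluence x y : ℝ) + Real.sqrt N * Λ x y) * Lφ *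
            suFrobDist (ω y) (η y) := by ring

/-- Row sums of the perturbed slab influence coefficients: `∑_{y ∈ nbr x} C(x,y) ≤ e^δ(1 + 2√N ℓ)·2n|β|K + √N·Λ₀` when the
cross-Lipschitz row loads are `≤ Λ₀`. [folklore] -/
theorem slabW_rowsum_le (x : TorusSite n L) {β K δ ℓ Λ₀ : ℝ} (hK : 0 ≤ K) (hℓ : 0 ≤ ℓ)
    (nbrW : TorusSite n L → Finset (TorusSite n L))
    (Λ : TorusSite n L → TorusSite n L → ℝ) (hrow : ∑ y ∈ Slab.slabNbr x ∪ nbrW x, Λ x y ≤ Λ₀) :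
    ∑ y ∈ Slab.slabNbr x ∪ nbrW x,
        (K * Real.exp δ * (1 + 2 * Real.sqrt N * ℓ) * |β| * (Slab.slabInfluence x y : ℝ) + Real.sqrt N * Λ x y) ≤
      Real.exp δ * (1 + 2 * Real.sqrt N * ℓ) * (2 * (n : ℝ) * |β| * K) + Real.sqrt N * Λ₀ := by
  classical
  have hnbr : Slab.slabNbr x ⊆ Slab.slabNbr x ∪ nbrW x := Finset.subset_union_left
  rw [Finset.sum_add_distrib, ← Finset.mul_sum, ← Finset.mul_sum]
  have hinfl : ∑ y ∈ Slab.slabNbr x ∪ nbrW x, (Slab.slabInfluence x y : ℝ) =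
      ∑ y ∈ Slab.slabNbr x, (Slab.slabInfluence x y : ℝ) := by
    rw [← Finset.sum_subset hnbr fun y _ hy => by rw [slabInfluence_eq_zero_of_not_mem hy, Nat.cast_zero]]
  have h2n : ∑ y ∈ Slab.slabNbr x, (Slab.slabInfluence x y : ℝ) ≤ 2 * (n : ℝ) := by
    exact_mod_cast Slab.sum_slabInfluence_le x
  rw [hinfl]
  refine add_le_add ?_ (mul_le_mul_of_nonneg_left hrow (Real.sqrt_nonneg _))
  calc K * Real.exp δ * (1 + 2 * Real.sqrt N * ℓ) * |β| * ∑ y ∈ Slab.slabNbr x, (Slab.slabInfluence x y : ℝ)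
      ≤ K * Real.exp δ * (1 + 2 * Real.sqrt N * ℓ) * |β| * (2 * (n : ℝ)) :=
        mul_le_mul_of_nonneg_left h2n (by positivity)
    _ = Real.exp δ * (1 + 2 * Real.sqrt N * ℓ) * (2 * (n : ℝ) * |β| * K) := by ring

/-- **ROBUST SLAB DOOR (covariance form).**  Under the hypotheses of `isKRContraction_slabSpecW` and the row-sum bound
`c := e^δ(1 + 2√N ℓ)·2n|β|K + √N Λ₀ ≤ 1`, for EVERY rest `r`, all bounded measurable single-site observables `f, g` at `x, y` with
Frobenius-Lipschitz constants `δf, δg`, and every profile `ℓ'` vanishing at `y` and 1-Lipschitz along `nbr`: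
`|Cov_{slabLawW}(f, g)| ≤ 2(2√N)² δg δf c^{ℓ' x}` — no dependence on `r`, `L`, the boundary fields beyond `c`.
[cite: CaoNissimSheffield2025dynamical, Def. 2.1 and Thm. 2.3] [cite: Follmer1988, Ch. I Theorem (2.13)] -/
theorem slab_covariance_le_W (hN : 1 ≤ N) (hL1 : L ≠ 1) (v : Fin (n + 1)) (t : ZMod L)
    {β R K δ ℓ Λ₀ : ℝ} (hK : 0 ≤ K) (hℓ : 0 ≤ ℓ) (hR : |β| * (2 * (n : ℝ)) ≤ R) (hmod : OneLinkKRModulus N R K)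
    (hWm : Measurable W) (hWb : ∃ C, ∀ U, |W U| ≤ C) (r : {e : Edge (n + 1) L // ¬ IsSlab v t e} → SU N)
    (nbrW : TorusSite n L → Finset (TorusSite n L)) (hnotW : ∀ x, x ∉ nbrW x)
    (hdep : ∀ x (η η' : TorusSite n L → SU N), (∀ z ∈ Slab.slabNbr x ∪ nbrW x, η z = η' z) →
      ∃ c : ℝ, ∀ g, siteTiltW v t W r x η g = c + siteTiltW v t W r x η' g)
    (hδ : ∀ x ω g g', siteTiltW v t W r x ω g - siteTiltW v t W r x ω g' ≤ δ)
    (hℓ' : ∀ x ω g g', |siteTiltW v t W r x ω g - siteTiltW v t W r x ω g'| ≤ ℓ * suFrobDist g g')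
    (Λ : TorusSite n L → TorusSite n L → ℝ) (hΛ0 : ∀ x y, 0 ≤ Λ x y)
    (hΛ : ∀ x y (ω η : TorusSite n L → SU N), (∀ z, z ≠ y → ω z = η z) → ∃ c : ℝ, ∀ g,
      |siteTiltW v t W r x ω g - (c + siteTiltW v t W r x η g)| ≤ Λ x y * suFrobDist (ω y) (η y))
    (hrow : ∀ x, ∑ y ∈ Slab.slabNbr x ∪ nbrW x, Λ x y ≤ Λ₀)
    (hc1 : Real.exp δ * (1 + 2 * Real.sqrt N * ℓ) * (2 * (n : ℝ) * |β| * K) + Real.sqrt N * Λ₀ ≤ 1)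
    (x y : TorusSite n L)
    {f g : (TorusSite n L → SU N) → ℝ} (hfm : Measurable f) (hfdep : DependsOn f ({x} : Set (TorusSite n L)))
    {Mf : ℝ} (hMf : ∀ σ, |f σ| ≤ Mf) {δf : ℝ} (hδf : IsLipBound suFrobDist f fun z => if z = x then δf else 0)
    (hgm : Measurable g) (hgdep : DependsOn g ({y} : Set (TorusSite n L))) {Mg : ℝ} (hMg : ∀ σ, |g σ| ≤ Mg)
    {δg : ℝ} (hδg : IsLipBound suFrobDist g fun z => if z = y then δg else 0)
    (prof : TorusSite n L → ℕ) (hprof0 : prof y = 0)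
    (hprof : ∀ z, z ≠ y → ∀ w ∈ Slab.slabNbr z ∪ nbrW z, prof z ≤ prof w + 1) :
    |cov[f, g; slabLawW v t β W r]| ≤
      2 * (2 * Real.sqrt N) ^ 2 * δg *
        ((Real.exp δ * (1 + 2 * Real.sqrt N * ℓ) * (2 * (n : ℝ) * |β| * K) + Real.sqrt N * Λ₀) ^ prof x * δf) := by
  classical
  have hγ := isSpecification_slabSpecW (n := n) (L := L) v t β hWm hWb r
  have hKR := isKRContraction_slabSpecW hN hL1 v t hK hℓ hR hmod hWm hWb r nbrW hnotW hdep hδ hℓ' Λ hΛ0 hΛ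
  have hc0 : 0 ≤ Real.exp δ * (1 + 2 * Real.sqrt N * ℓ) * (2 * (n : ℝ) * |β| * K) + Real.sqrt N * Λ₀ := by
    have hΛ₀ : 0 ≤ Λ₀ := (Finset.sum_nonneg fun z _ => hΛ0 x z).trans (hrow x)
    positivity
  have key := abs_covariance_le_of_isKRContraction hγ hKR suFrobDist_nonneg suFrobDist_le (by positivity) hc0 hc1
    (fun z => slabW_rowsum_le z hK hℓ nbrW Λ (hrow z)) (isGibbsMeasure_slabLawW v t β hWm hWb r) hfm (Δf := {x})
    (by simpa using hfdep) hMf hδf hgm (Δg := {y}) (by simpa using hgdep) hMg hδg prof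
    (fun z hz => by rw [Finset.mem_singleton.1 hz, hprof0]) (fun z hz w hw => hprof z (by simpa using hz) w hw)
  simpa using key

end Door

end Summit.Ventures.YMGap.RobustBall
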